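import Mathlib
import Summits.ValiantsHypothesis.ValiantsHypothesis.Theorems.NewtonUnitEquationsDissociatedUniformTotalsLaw
import Summits.ValiantsHypothesis.ValiantsHypothesis.Theorems.NewtonUnitEquationsDissociatedUniformTotalsLawUnion
import Summits.ValiantsHypothesis.ValiantsHypothesis.Theorems.NewtonUnitEquationsDissociatedUniformTotalsLawUnionVertBound
import Summits.ValiantsHypothesis.ValiantsHypothesis.Theorems.NewtonUnitEquationsDissociatedUniformTotalsLawAverageUnion
import HarnessLib

/-!
# Crux `NewtonUnitEquations.DissociatedUniform` (stmt-ValiantsHypothesis-5905): the AVERAGE UNION RUNG, typed — `AverageUnionBound C` (PROVED for `C = 1584000`, located `C ≈ 2`) and its place among the union rungs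

Typed form of the average union law of `…TotalsLawAverageUnion` (memo `Cruxes/DissociatedUniform/NOTES-t1g12.md` §2), so that planners and
refuters can cite it by name next to the OPEN rungs `UnionVertBound C` (pointwise, every `Z`, every class) and `UnionTotalsLaw C` (totals,
every `Z`):
* `AverageUnionBound C` : for every finite abelian `G`, all `a b : G → ℝ²` and every class `s`,
  `∑_{Z ⊆ G} #vert conv U_s(Z) ≤ C · |G| · 2^{|G|}` — the MEAN over the `2^{|G|}` position sets of the union hull size is `≤ C|G|`.
  **PROVED**: `averageUnionBound_holds : AverageUnionBound 1584000` (`…AverageUnion.sum_unionVert_le`).  Located value from the census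
  (exp/avg_union.py, all subfamilies, `q ≤ 11`): mean `0.8–1.3 |G|`, so `C = 2` is the conjectured sharp constant (not asserted).
* the ladder: `UnionVertBound C → AverageUnionBound C` (pointwise ⇒ mean, `averageUnionBound_of_unionVertBound`) and
  `AverageUnionBound C →` "`UnionTotalsLaw C` on average" (`sum_unionTotal_le_of_averageUnionBound`:
  `∑_Z unionTotal a b Z ≤ C|G|²2^{|G|}`); neither converse is claimed.  The mean rung is the first union rung CLOSED with an explicit constant
  for arbitrary labellings; the every-`Z` rungs stay OPEN.
Honest label: `UnionVertBound`, `UnionTotalsLaw`, `TotalsLawThree` remain OPEN; nothing here bears on VP ≠ VNP.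
[folklore: averaging]
-/

set_option linter.dupNamespace false -- `ValiantsHypothesis.ValiantsHypothesis` (summit = problem) in every name

open scoped BigOperators

namespace Summit.ValiantsHypothesis.ValiantsHypothesis.Theorems.NewtonUnitEquationsDissociatedUniform

namespace TotalsLaw

/-- **The average union bound with constant `C`**: for every finite abelian `G` (with decidable equality, to enumerate its subsets), all
`a b : G → ℝ²` and every class `s`, the sum over all position sets `Z ⊆ G` of `#vert conv U_s(Z)` is at most `C·|G|·2^{|G|}` (mean `≤ C|G|`).
PROVED for `C = 1584000` (`averageUnionBound_holds`); census value `C ≈ 2`. -/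
@[conjecture] def AverageUnionBound (C : ℕ) : Prop :=
  ∀ (G : Type) [AddCommGroup G] [Fintype G] [DecidableEq G] (a b : G → (Fin 2 → ℝ)) (s : G),
    ∑ Z : Finset G, unionVert a b (Z : Set G) s ≤ C * Fintype.card G * 2 ^ Fintype.card G

/-- Monotonicity in the constant. -/
theorem averageUnionBound_mono {C C' : ℕ} (hCC' : C ≤ C') (h : AverageUnionBound C) : AverageUnionBound C' := by
  intro G _ _ _ a b s
  exact (h G a b s).trans (Nat.mul_le_mul_right _ (Nat.mul_le_mul_right _ hCC'))

/-- **THE AVERAGE UNION RUNG IS CLOSED**: `AverageUnionBound 1584000` holds (`…TotalsLawAverageUnion.sum_unionVert_le`). -/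
theorem averageUnionBound_holds : AverageUnionBound 1584000 := by
  intro G _ _ _ a b s
  exact sum_unionVert_le a b s

/-- **Pointwise ⇒ mean**: `UnionVertBound C → AverageUnionBound C` (sum the pointwise bound over the `2^{|G|}` position sets). -/
theorem averageUnionBound_of_unionVertBound {C : ℕ} (h : UnionVertBound C) : AverageUnionBound C := by
  intro G _ _ _ a b s
  calc ∑ Z : Finset G, unionVert a b (Z : Set G) s ≤ ∑ _Z : Finset G, C * Fintype.card G :=
        Finset.sum_le_sum fun Z _ => h G a b (Z : Set G) s
    _ = C * Fintype.card G * 2 ^ Fintype.card G := by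
        rw [Finset.sum_const, Finset.card_univ, Fintype.card_finset, smul_eq_mul]; ring

/-- **Mean ⇒ mean totals**: `AverageUnionBound C` gives `∑_Z unionTotal a b Z ≤ C·|G|²·2^{|G|}` ("`UnionTotalsLaw C` on average over the
position set"). -/
theorem sum_unionTotal_le_of_averageUnionBound {C : ℕ} (h : AverageUnionBound C) {G : Type} [AddCommGroup G] [Fintype G]
    [DecidableEq G] (a b : G → (Fin 2 → ℝ)) :
    ∑ Z : Finset G, unionTotal a b (Z : Set G) ≤ C * Fintype.card G ^ 2 * 2 ^ Fintype.card G := by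
  unfold unionTotal
  rw [Finset.sum_comm]
  calc ∑ s : G, ∑ Z : Finset G, unionVert a b (Z : Set G) s
      ≤ ∑ _s : G, C * Fintype.card G * 2 ^ Fintype.card G := Finset.sum_le_sum fun s _ => h G a b s
    _ = C * Fintype.card G ^ 2 * 2 ^ Fintype.card G := by
        rw [Finset.sum_const, Finset.card_univ, smul_eq_mul]; ring

/-- **Markov form of the mean rung**: under `AverageUnionBound C`, for every class `s` and every `λ`, the position sets whose union has more
than `λ|G|` hull vertices number at most `(C/λ)·2^{|G|}`: `λ · #{Z : λ|G| < #vert conv U_s(Z)} ≤ C · 2^{|G|}`. -/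
theorem card_filter_unionVert_gt_le {C : ℕ} (h : AverageUnionBound C) {G : Type} [AddCommGroup G] [Fintype G] [DecidableEq G]
    (a b : G → (Fin 2 → ℝ)) (s : G) (lam : ℕ) :
    lam * ((Finset.univ : Finset (Finset G)).filter fun Z : Finset G => lam * Fintype.card G < unionVert a b (↑Z : Set G) s).card ≤
      C * 2 ^ Fintype.card G := by
  classical
  set q := Fintype.card G with hq
  have hq1 : 0 < q := Fintype.card_pos
  set E := (Finset.univ : Finset (Finset G)).filter fun Z : Finset G => lam * q < unionVert a b (↑Z : Set G) s with hE
  have h1 : E.card * (lam * q) ≤ ∑ Z ∈ E, unionVert a b (Z : Set G) s := by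
    rw [← smul_eq_mul, ← Finset.sum_const]
    exact Finset.sum_le_sum fun Z hZ => (Finset.mem_filter.1 hZ).2.le
  have h2 : ∑ Z ∈ E, unionVert a b (Z : Set G) s ≤ ∑ Z : Finset G, unionVert a b (Z : Set G) s :=
    Finset.sum_le_sum_of_subset (Finset.subset_univ E)
  have key : (lam * E.card) * q ≤ (C * 2 ^ q) * q := by
    calc (lam * E.card) * q = E.card * (lam * q) := by ring
      _ ≤ C * q * 2 ^ q := h1.trans (h2.trans (h G a b s))
      _ = (C * 2 ^ q) * q := by ring
  exact Nat.le_of_mul_le_mul_right key hq1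

end TotalsLaw

end Summit.ValiantsHypothesis.ValiantsHypothesis.Theorems.NewtonUnitEquationsDissociatedUniform
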